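import Mathlib
import HarnessLib

/-!
# All-axes cylinder budget, O1c′ pack G: limit tools (general measure theory, no fluids)

Helper toward obligation O1c′ `CylinderBookkeepingSplit` of the «all-axes cylinder budget» line for
`GaldiLiouvilleGate.GaldiLiouville` (stmt-NavierStokesRegularity-0895; Defs of record
`…Theorems.GaldiLiouvilleGateCylinderBudgetsDefs`, v3.1 817120c4c833a18a). Statements VERBATIM from
the arbiter's kit `pub/ns-inputs/kits/allaxes-O1c-limit-sigs.lean` (sha16 935d1df3dddf7f1f,
ns-in-ser-a g2 2026-08-28 12:32:09Z, pack G → ns-in-wu-p33 g2):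

* G1 `tendsto_setLIntegral_inter_antitone` — `∫_{A ∩ Bₙ} f → 0` when `∫_A f < ∞` and the
  measurable `Bₙ` decrease with every point eventually outside (continuity from above of the
  finite measure `(μ|_A).withDensity f`);
* G2 `tendsto_setLIntegral_monotone` — `∫_{Sₙ} f → ∫_{⋃ Sₙ} f` for increasing `Sₙ` (any sets; `μ`
  s-finite; continuity from below of `μ.withDensity f`, `withDensity_apply'`);
* G3 `tendsto_closedWindow_of_openWindow` — the two-window lemma: the open dyadic windows at `R` and
  `3R/2` cover the half-closed window `{R² < s ≤ 4R²}` (`s = x₀² + x₁²`), so the open-window decay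
  `R⁻²∫ f → 0` gives `K R⁻² ∫_{R² < s ≤ 4R²} f → 0`.

[folklore] Theorems only, standard axioms, no `sorry`.

WHAT THIS IS NOT: not a proof of ⟨0895⟩/⟨0896⟩ nor of any NS regularity statement.
-/

set_option linter.dupNamespace false

noncomputable section

open MeasureTheory Set Filter Topology
open scoped ENNReal Topology

namespace Summit.NavierStokesRegularity.NavierStokesRegularity.Theorems.GaldiLiouville.AllAxesBudget

/-- G1 · set integrals over `A ∩ B n` vanish when `∫_A f < ∞` and the measurable sets `B n` decrease to nothing. [folklore] -/
theorem tendsto_setLIntegral_inter_antitone {α : Type*} [MeasurableSpace α] {μ : Measure α}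
    {f : α → ℝ≥0∞} {A : Set α} (hA : ∫⁻ x in A, f x ∂μ ≠ ⊤)
    {B : ℕ → Set α} (hB : Antitone B) (hBm : ∀ n, MeasurableSet (B n)) (hBe : ∀ x, ∃ n, x ∉ B n) :
    Tendsto (fun n => ∫⁻ x in A ∩ B n, f x ∂μ) atTop (𝓝 0) := by
  set ν : Measure α := (μ.restrict A).withDensity f with hν
  have hrew : ∀ n, ∫⁻ x in A ∩ B n, f x ∂μ = ν (B n) := by
    intro n
    rw [hν, withDensity_apply _ (hBm n), Measure.restrict_restrict (hBm n), inter_comm]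
  simp_rw [hrew]
  have hinter : (⋂ n, B n) = ∅ := by
    ext x
    simp only [mem_iInter, mem_empty_iff_false, iff_false, not_forall]
    exact hBe x
  have hfin : ∃ n, ν (B n) ≠ ⊤ := by
    refine ⟨0, ne_top_of_le_ne_top hA ?_⟩
    rw [← hrew 0]
    exact lintegral_mono_set inter_subset_left
  have h := tendsto_measure_iInter_atTop (μ := ν) (fun n => (hBm n).nullMeasurableSet) hB hfin
  rw [hinter, measure_empty] at h
  exact h

/-- G2 · monotone convergence of set integrals along an increasing sequence of sets (no measurability needed). [folklore] -/
theorem tendsto_setLIntegral_monotone {α : Type*} [MeasurableSpace α] {μ : Measure α} [SFinite μ]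
    {f : α → ℝ≥0∞} {S : ℕ → Set α} (hS : Monotone S) :
    Tendsto (fun n => ∫⁻ x in S n, f x ∂μ) atTop (𝓝 (∫⁻ x in ⋃ n, S n, f x ∂μ)) := by
  have h := tendsto_measure_iUnion_atTop (μ := μ.withDensity f) hS
  simp only [Function.comp_def, withDensity_apply'] at h
  exact h

/-- G3 · TWO-WINDOW LEMMA: the dyadic-window decay `R⁻² ∫_{R² < s < 4R²} f → 0` (windows open at both ends)
gives `K R⁻² ∫_{R² < s ≤ 4R²} f → 0` (window closed at the outer end), covering `{R² < s ≤ 4R²}` by the windows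
at `R` and at `3R/2`.  Here `s = x₀² + x₁²`. [folklore] -/
theorem tendsto_closedWindow_of_openWindow {f : EuclideanSpace ℝ (Fin 3) → ℝ≥0∞} {K : ℝ} (hK : 0 ≤ K)
    (h : Tendsto (fun R : ℝ => ENNReal.ofReal (R⁻¹ ^ 2) *
      ∫⁻ x in {x : EuclideanSpace ℝ (Fin 3) | R ^ 2 < x 0 ^ 2 + x 1 ^ 2 ∧ x 0 ^ 2 + x 1 ^ 2 < 4 * R ^ 2}, f x)
      atTop (𝓝 0)) :
    Tendsto (fun R : ℝ => ENNReal.ofReal (K / R ^ 2) *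
      ∫⁻ x in {x : EuclideanSpace ℝ (Fin 3) | R ^ 2 < x 0 ^ 2 + x 1 ^ 2 ∧ x 0 ^ 2 + x 1 ^ 2 ≤ 4 * R ^ 2}, f x)
      atTop (𝓝 0) := by
  -- the open window at `R'`, as a function of `R'`
  set W : ℝ → ℝ≥0∞ := fun R => ENNReal.ofReal (R⁻¹ ^ 2) *
    ∫⁻ x in {x : EuclideanSpace ℝ (Fin 3) | R ^ 2 < x 0 ^ 2 + x 1 ^ 2 ∧ x 0 ^ 2 + x 1 ^ 2 < 4 * R ^ 2}, f x
    with hW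
  have hW1 : Tendsto W atTop (𝓝 0) := h
  have hW2 : Tendsto (fun R : ℝ => W (3 / 2 * R)) atTop (𝓝 0) :=
    h.comp (tendsto_id.const_mul_atTop (by norm_num : (0 : ℝ) < 3 / 2))
  -- the majorant `K · W R + (9K/4) · W (3R/2) → 0`
  have hmaj : Tendsto (fun R : ℝ => ENNReal.ofReal K * W R + ENNReal.ofReal (9 * K / 4) * W (3 / 2 * R))
      atTop (𝓝 0) := by
    have h1 := ENNReal.Tendsto.const_mul hW1 (Or.inr ENNReal.ofReal_ne_top) (a := ENNReal.ofReal K)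
    have h2 := ENNReal.Tendsto.const_mul hW2 (Or.inr ENNReal.ofReal_ne_top)
      (a := ENNReal.ofReal (9 * K / 4))
    rw [mul_zero] at h1 h2
    simpa using h1.add h2
  refine tendsto_of_tendsto_of_tendsto_of_le_of_le' tendsto_const_nhds hmaj
    (Eventually.of_forall fun _ => zero_le) ?_
  filter_upwards [eventually_gt_atTop (0 : ℝ)] with R hR
  -- cover the half-closed window by the two open windows
  have hcover : {x : EuclideanSpace ℝ (Fin 3) | R ^ 2 < x 0 ^ 2 + x 1 ^ 2 ∧ x 0 ^ 2 + x 1 ^ 2 ≤ 4 * R ^ 2} ⊆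
      {x : EuclideanSpace ℝ (Fin 3) | R ^ 2 < x 0 ^ 2 + x 1 ^ 2 ∧ x 0 ^ 2 + x 1 ^ 2 < 4 * R ^ 2} ∪
      {x : EuclideanSpace ℝ (Fin 3) | (3 / 2 * R) ^ 2 < x 0 ^ 2 + x 1 ^ 2 ∧
        x 0 ^ 2 + x 1 ^ 2 < 4 * (3 / 2 * R) ^ 2} := by
    intro x hx
    simp only [mem_setOf_eq, mem_union] at hx ⊢
    by_cases h4 : x 0 ^ 2 + x 1 ^ 2 < 4 * R ^ 2
    · exact Or.inl ⟨hx.1, h4⟩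
    · right
      have hR2 : 0 < R ^ 2 := by positivity
      constructor <;> nlinarith [hx.2, not_lt.1 h4]
  have hsplit : ∫⁻ x in {x : EuclideanSpace ℝ (Fin 3) | R ^ 2 < x 0 ^ 2 + x 1 ^ 2 ∧ x 0 ^ 2 + x 1 ^ 2 ≤ 4 * R ^ 2}, f x ≤
      (∫⁻ x in {x : EuclideanSpace ℝ (Fin 3) | R ^ 2 < x 0 ^ 2 + x 1 ^ 2 ∧ x 0 ^ 2 + x 1 ^ 2 < 4 * R ^ 2}, f x) +
      ∫⁻ x in {x : EuclideanSpace ℝ (Fin 3) | (3 / 2 * R) ^ 2 < x 0 ^ 2 + x 1 ^ 2 ∧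
        x 0 ^ 2 + x 1 ^ 2 < 4 * (3 / 2 * R) ^ 2}, f x :=
    (lintegral_mono_set hcover).trans (lintegral_union_le _ _ _)
  -- the scalar identities `K/R² = K · R⁻²` and `K/R² = (9K/4) · (3R/2)⁻²`
  have hKR : ENNReal.ofReal (K / R ^ 2) = ENNReal.ofReal K * ENNReal.ofReal (R⁻¹ ^ 2) := by
    rw [← ENNReal.ofReal_mul hK]; congr 1; rw [inv_pow, div_eq_mul_inv]
  have hKR' : ENNReal.ofReal (K / R ^ 2) =
      ENNReal.ofReal (9 * K / 4) * ENNReal.ofReal ((3 / 2 * R)⁻¹ ^ 2) := by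
    rw [← ENNReal.ofReal_mul (by positivity)]; congr 1; field_simp; ring
  calc ENNReal.ofReal (K / R ^ 2) *
        ∫⁻ x in {x : EuclideanSpace ℝ (Fin 3) | R ^ 2 < x 0 ^ 2 + x 1 ^ 2 ∧ x 0 ^ 2 + x 1 ^ 2 ≤ 4 * R ^ 2}, f x
      ≤ ENNReal.ofReal (K / R ^ 2) *
        ((∫⁻ x in {x : EuclideanSpace ℝ (Fin 3) | R ^ 2 < x 0 ^ 2 + x 1 ^ 2 ∧ x 0 ^ 2 + x 1 ^ 2 < 4 * R ^ 2}, f x) +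
        ∫⁻ x in {x : EuclideanSpace ℝ (Fin 3) | (3 / 2 * R) ^ 2 < x 0 ^ 2 + x 1 ^ 2 ∧
          x 0 ^ 2 + x 1 ^ 2 < 4 * (3 / 2 * R) ^ 2}, f x) := mul_le_mul' le_rfl hsplit
    _ = ENNReal.ofReal K * W R + ENNReal.ofReal (9 * K / 4) * W (3 / 2 * R) := by
        rw [mul_add, hW]
        dsimp only
        rw [← mul_assoc, ← mul_assoc, ← hKR, ← hKR']

end Summit.NavierStokesRegularity.NavierStokesRegularity.Theorems.GaldiLiouville.AllAxesBudget

end
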